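import Summits.QuantumFields.YangMills.Theorems.BalabanUVNodesClustersCore
import Literature.MathematicalPhysics.QuantumFieldTheory.Balaban1983to89.B14NodeKnitRecord9
import Literature.MathematicalPhysics.QuantumFieldTheory.Balaban1983to89.Node00.Record12

/-!
# DAG node N11 — [B14] `Dag.B14_main` ([Balaban1988Convergent] CMP **119** (1988) 243–285: Theorem 1 p. 262, with the Theorem of p. 245 and the
# operation 𝐑 ASSUMED on p. 244) AT NODE 00's STAGE-12 RECORD `Node00.IsRecordOfRecord₁₂C` (`Node00/Record12.lean`): the route's stub
# `YMDAG.UVSplit.S_N11 Rec := AtRecord Rec Dag.B14_main` at `Rec := IsRecordOfRecord₁₂C · N` with the (𝐑) slot DISCHARGED BY THE PIN, the §2-form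
# reading `Iff.rfl`, AND THE START (S0) A THEOREM (`Node00.sLaw₁₂_zero`) — N11 at a Stage-12 world = (S1ᵀ) ALONE: the Theorem of p. 245 at the objects of record

Cell `pub-ymgap`, YM-PLAN Track A (HUMAN RULING D-0062), seat `pub-ymgap-dag-n11-d` (R134 fan-out seat N11, strategy s2 «Thm 1 with 𝐑 explicit at the record
now that `Sect2Form` is PINNED — the T-DAY consumer»; director-ym LINE №81 (3) «every ₁₁ module re-instantiates at `Record12`», LINE №82∕№83 (rev 8 at ₁₂)).
[III] = Balaban1988Convergent, [II′] = Balaban1989LargeFieldII.  The Stage-12 twin of seat dag-n11-c's `…BalabanUVNodesN11AtRecord11C` (p450088).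

WHY THIS FILE.  At Stage 11 the node's start slot (S0) «under the interval hypothesis `ρ₀` of record has the §2 form at index 0» (`SLaw₁₁ θ P 0`) was
UNSATISFIABLE (the level-0 background map of record read no configuration: `B16Thm1BaseAtRecord11.not_sLaw₁₁_zero`,
`BalabanUVNodesN11AtRecord11Vacuity.b14_main_iff_antecedents_false`), so every Stage-11 knit of N11 was vacuous.  NODE 00's Stage 12 (`Record12`, seat
node00-def-T, FILE 12b) REPAIRS the pin: the level-0 background map is the print's `U₀(𝐖) = 𝐖 0` and the format predicates carry the whole-slot dichotomy
for absent sequences; there `SLaw₁₂ θ P 0` is a THEOREM (`sLaw₁₂_zero`: zero terms, `E_0 = E` of the run, the identity `ρ₀(V₀) = exp[−A(1∕g₀², V₀) − E]` at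
every `V₀`), the core's §2 clause IS `SLaw₁₂` (`sect2Form_coreOfRecord₁₂_iff`, `Iff.rfl`) and the record's 𝐑-leaf IS «`∀ k < K, TLaw₁₂ θ P k → SLaw₁₂ θ P (k+1)`»
(`rOperation_upOfRecord₅C_stage12_iff`; [II′] Thm 1's content, node N13's product).  Hence at a Stage-12 world N11 needs no (𝐑) hypothesis, no reading
hypothesis AND NO START HYPOTHESIS: `Dag.B14_main (leavesP w P)` follows from EXACTLY (S1ᵀ) THE THEOREM OF [III] p. 245 AT THE OBJECTS OF RECORD —
«given N11's antecedents `b7 … b11`, the interval hypothesis, the small-field inductive assumptions and the flow control (2.6): for `k < K`, if `ρ_k` of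
record has the repaired §2 form then `𝐓ρ_k` of record has the repaired 𝐓-image form» (`SLaw₁₂ θ P k → TLaw₁₂ θ P k`; [III] §1 for `k = 0`, §3 + Thm 2
for `k ≥ 1`) — via the n11-a lineage's construction-generic `B14NodeKnitRecord9.b14_main_at_construction_rhoOfRecord9_along` (slot recursion
`slotsOfRecord_succ`, `rfl`) with `LawsP := SLaw₁₂`, `LawsTP := TLaw₁₂`, `hS9 := Iff.rfl`, `h0 := sLaw₁₂_zero`, `hR :=` the pin.

WHAT THIS FILE PROVES (0 `sorry`, 0 `def`, standard axioms).  §1 POINTED, at Stage-12 parameters `θ` under their provisos `h` and a world `w` with `w.C =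
(datumOfRecord₁₂ F N θ h).C`, `w.up P = upOfRecord₅C F N (θ.toStage5₁₂ F N) P`: `rOperation_iff_laws₁₂` (the leaf unfolded), `densitiesDescribed_iff_sLaw₁₂`
(N11's CONCLUSION at `(w, P)` IS «every `ρ_k` of record, `k ≤ K`, has the repaired §2 form»), **`b14_main_at_record₁₂`** (N11 from (S1ᵀ) ALONE),
**`b14_main_iff_at_record₁₂`** (N11 UNFOLDED at ₁₂C, both directions), `sLaw₁₂_all_of_b14_main` (A4 locator: N11 + its antecedent leaves + law transport
YIELD the repaired §2 form of every density of record — NON-VACUOUS at ₁₂: the `k = 0` instance is a theorem, the `k ≥ 1` instances the repaired format laws),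
`sLaw₁₂_all_of_tLaw` (Thm 1 [III]'s conclusion along the run from (S1ᵀ) + the leaf's law transport, no world: `B14.inductiveAssumptions_of_thmP245`'s logic at
the objects of record), `sLaw₁₂_all_of_rOpLeaf` (the same from the 𝐑-leaf BY NAME, `DagBinding.ROpLeaf (VOfRecord₁₂ θ P)` — the N11∕N13 junction at ₁₂).  §2 KEYED on `IsRecordOfRecord₁₂C`: `leaf_b7_of_isRecordOfRecord₁₂C`, `guards_of_isRecordOfRecord₁₂C` (in-edges `b4 b5 b7` HOLD at every
run of every Stage-12 record, `Record12` §7's transfers), **`b14_main_of_isRecordOfRecord₁₂C`** (per-(D, w): (S1ᵀ) for every presenting `θ` ⇒ N11 at every run),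
**`s_N11_of_refines₁₂C`**, **`s_N11_rec₁₂C`** (`S_N11` AT `IsRecordOfRecord₁₂C · N` ITSELF from (S1ᵀ) alone).  §3 THE (B)-FACE: `thm1Printed_of_b14_main_all`
(generic: N11 at every run of a binding world + its antecedents inside the window ⊢ `B16.Thm1Printed D.C`, Theorem 1's conjunct of the pin (B)),
`thm1Printed_of_isRecordOfRecord₁₂C_of_tLaw` (at a Stage-12 record: (S1ᵀ) + the antecedents ⊢ Thm 1's conjunct — what the route's K1′ witness owes N11).

HONEST FRAMING.  A count-neutral KNIT BY NAME (R429 (4)(i)); N11 is NOT discharged: (S1ᵀ) = [III] Sects. 1–3 + Thm 2 at the slots of record is a DISPLAYED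
hypothesis (Bałaban's renormalization-transformation estimates, proved nowhere in the tree for the objects of record); (S0) is NO LONGER a hypothesis (a
theorem of `Record12`); the (𝐑) slot is NOT assumed — it is what the record's leaf SAYS ([II′] Thm 1's content, node N13's product); the in-edges `b8 b9 b10 b11`
(N05 ∕ N06 ∕ N08 ∕ N07), the small-field leaf (N09 ∧ N10) and the flow control stay antecedents AS PRINTED.  `IsRecordOfRecord₁₂C` is NOT known inhabited
(K0′ at rev 8); RIDER №7: `N`-generic (`[NeZero N]`), the route instantiates `F 2`.  LOCATED (dag-ref-H's `Record12` SWEEP note (S3), def-T's JUNK (i)): the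
residual 𝐓-weight datum `Zt` of a Stage-12 record is bound only by `ζ0 ≥ 0`, so admissible records with `ζ ≡ 0` exist, at which every §2-form slot of level
`≥ 1` is the zero density and (S1ᵀ) FAILS already at `k = 0` (`SLaw₁₂ θ P 0` holds, `TLaw₁₂ θ P 0` does not); hence the ∀-record forms of §2 are correct
IMPLICATIONS whose hypothesis `step` is dischargeable only over record classes excluding such weights, and THE DISCHARGE CURRENCY FOR N11 IS THE POINTED FORM
`b14_main_at_record₁₂` AT A NON-DEGENERATE PRESENTING `θ` (the witness record of the route's K1′ item) — exactly where [III]'s Theorem of p. 245 is a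
statement about Bałaban's operation 𝐓.  One finite four-torus programme at fixed `ε`, Bałaban AS PRINTED with
locators; NOT ℝ⁴, NOT infinite volume, NOT OS, NOT a mass gap, NOT Clay.  Sources: [III] Thm 1 p. 262, Theorem p. 245, p. 244, (2.18) p. 257, (2.23)–(2.42)
pp. 258–261, Thm 2 p. 263, (3.24)–(3.25) p. 270; [II′] Thm 1 p. 355; [Balaban1989LargeFieldI] (0.2)–(0.4) p. 176.
-/

noncomputable section

open scoped BigOperators

namespace Summit.QuantumFields.YangMills.Theorems.BalabanUVNodesN11AtRecord12C

open Literature.MathematicalPhysics.QuantumFieldTheory.Balaban1983to89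
open Literature.MathematicalPhysics.QuantumFieldTheory.Balaban1983to89.T4Continuum (T4Family FiniteEpsData)
open Literature.MathematicalPhysics.QuantumFieldTheory.Balaban1983to89.DagBinding (WorldP leavesP)
open Literature.MathematicalPhysics.QuantumFieldTheory.Balaban1983to89.Node00
open Literature.MathematicalPhysics.QuantumFieldTheory.Balaban1983to89.B14NodeKnitRecord9
  (b14_main_at_construction_rhoOfRecord9_along densitiesDescribed_iff_laws_construction)
open YMDAG.UVSplit (Datum RecordPred AtRecord S_N11)

variable (F : T4Family) (N : ℕ) [NeZero N]

/-! ## §1. N11 at a Stage-12 world, POINTED at the presenting parameters -/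

section Pointed

variable (θ : Stage12Params F N) (h : θ.Provisos₁₂ F N) (w : WorldP) (P : B12.RunParams)

/-- **The record's 𝐑-leaf at the run `P`, UNFOLDED** (Stage 12): for a world bound to the C-binding of record over the Stage-12 view (`hup`),
`(leavesP w P).rOperation` IS «for every `k < K`: if `𝐓ρ_k` of record has the repaired 𝐓-image form (`TLaw₁₂`) then `ρ_{k+1} = 𝐑𝐓ρ_k` of record has the
repaired §2 form (`SLaw₁₂`)» — [Balaban1988Convergent] p. 244's assumed property of 𝐑 at the objects of record (`Node00.rOperation_upOfRecord₅C_stage12_iff`).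
[cite: Balaban1988Convergent, p.244 and Thm 2 p.263; Balaban1989LargeFieldII, Thm 1 p.355 (bookkeeping: the leaf unfolded)] -/
theorem rOperation_iff_laws₁₂ (hup : w.up P = upOfRecord₅C F N (θ.toStage5₁₂ F N) P) :
    (leavesP w P).rOperation ↔ ∀ k, k < P.K → TLaw₁₂ F N θ P k → SLaw₁₂ F N θ P (k + 1) := by
  show (w.up P).rOperation ↔ _
  rw [hup]
  exact rOperation_upOfRecord₅C_stage12_iff F N θ P

/-- **N11's CONCLUSION at a Stage-12 world IS «every density of record `ρ_k`, `k ≤ K`, has the REPAIRED §2 [III] form of record»** (`SLaw₁₂ θ P k`: the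
post-𝐑 slot family at the 𝐓-weights of record and the repaired background maps, whole-slot dichotomy, `Node00.sLaw₁₂_iff`): the core's clause is the pin
(`sect2Form_coreOfRecord₁₂_iff`, `Iff.rfl`). [cite: Balaban1988Convergent, Thm 1 p.262, (2.18) p.257, (2.23)–(2.42) pp.258–261 (bookkeeping)] -/
theorem densitiesDescribed_iff_sLaw₁₂ (hC : w.C = (datumOfRecord₁₂ F N θ h).C) :
    (leavesP w P).densitiesDescribed ↔ ∀ k, k ≤ P.K → SLaw₁₂ F N θ P k :=
  densitiesDescribed_iff_laws_construction F N (coreOfRecord₁₂ F N θ) w P θ.ν θ.τ9 (EOfRecord₁₀ F N θ.toStage9Params)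
    (wOfRecord₉ F N θ.toStage9Params) θ.ppSel (gOfRecord₁₀ F N θ.toStage9Params) (fun p k _ => SLaw₁₂ F N θ p k)
    (hC.trans (datumOfRecord₁₂_C F N θ h)) (fun _ _ => Iff.rfl)

/-- **N11 AT A STAGE-12 WORLD FROM (S1ᵀ) ALONE** ([Balaban1988Convergent] Thm 1 p. 262 with the Theorem of p. 245; the 𝐑 of p. 244 DISCHARGED BY THE PIN, the
START by `Node00.sLaw₁₂_zero`): at `w.C = (datumOfRecord₁₂ F N θ h).C`, `w.up P = upOfRecord₅C F N (θ.toStage5₁₂ F N) P`, `Dag.B14_main (leavesP w P)` follows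
from (S1ᵀ) `hT` — THE THEOREM OF p. 245 AT THE OBJECTS OF RECORD: GIVEN N11's in-edges `b7 … b11`, the interval hypothesis, the small-field inductive
assumptions and the flow control (2.6), for `k < K`, `SLaw₁₂ θ P k → TLaw₁₂ θ P k` ([III] §1 for `k = 0`, §3 + Thm 2 for `k ≥ 1`).  n11-a's
`B14NodeKnitRecord9.b14_main_at_construction_rhoOfRecord9_along` BY NAME with `h0 := sLaw₁₂_zero`. [cite: Balaban1988Convergent, Thm 1 p.262; Theorem p.245; p.244; (2.18) p.257; (3.24)–(3.25) p.270] -/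
theorem b14_main_at_record₁₂ (hC : w.C = (datumOfRecord₁₂ F N θ h).C) (hup : w.up P = upOfRecord₅C F N (θ.toStage5₁₂ F N) P)
    (hT : (leavesP w P).b7 → (leavesP w P).b8 → (leavesP w P).b9 → (leavesP w P).b10 → (leavesP w P).b11 →
      (leavesP w P).smallCouplings → (leavesP w P).smallFieldInductive → (leavesP w P).flowControl →
        ∀ k, k < P.K → SLaw₁₂ F N θ P k → TLaw₁₂ F N θ P k) :
    Dag.B14_main (leavesP w P) :=
  b14_main_at_construction_rhoOfRecord9_along F N (coreOfRecord₁₂ F N θ) w P θ.ν θ.τ9 (EOfRecord₁₀ F N θ.toStage9Params)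
    (wOfRecord₉ F N θ.toStage9Params) θ.ppSel (gOfRecord₁₀ F N θ.toStage9Params) (fun p k _ => SLaw₁₂ F N θ p k)
    (fun p k _ => TLaw₁₂ F N θ p k) (hC.trans (datumOfRecord₁₂_C F N θ h)) (fun _ _ => Iff.rfl) (fun _ => sLaw₁₂_zero F N θ P) hT
    (fun hrop => (rOperation_iff_laws₁₂ F N θ w P hup).1 hrop)

/-- **N11 UNFOLDED AT A STAGE-12 WORLD — what the node SAYS there, both directions**: `Dag.B14_main (leavesP w P)` IS «`b7 → b8 → b9 → b10 → b11 →
(smallCouplings → smallFieldInductive) → (smallCouplings → flowControl) → (∀ k < K, TLaw₁₂ θ P k → SLaw₁₂ θ P (k+1)) → smallCouplings → ∀ k ≤ K,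
SLaw₁₂ θ P k`». [cite: Balaban1988Convergent, Thm 1 p.262; Theorem p.245; p.244 (the node statement read at the objects of record; bookkeeping)] -/
theorem b14_main_iff_at_record₁₂ (hC : w.C = (datumOfRecord₁₂ F N θ h).C) (hup : w.up P = upOfRecord₅C F N (θ.toStage5₁₂ F N) P) :
    Dag.B14_main (leavesP w P) ↔
      ((leavesP w P).b7 → (leavesP w P).b8 → (leavesP w P).b9 → (leavesP w P).b10 → (leavesP w P).b11 →
        ((leavesP w P).smallCouplings → (leavesP w P).smallFieldInductive) →
        ((leavesP w P).smallCouplings → (leavesP w P).flowControl) →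
        (∀ k, k < P.K → TLaw₁₂ F N θ P k → SLaw₁₂ F N θ P (k + 1)) →
        (leavesP w P).smallCouplings → ∀ k, k ≤ P.K → SLaw₁₂ F N θ P k) := by
  unfold Dag.B14_main
  rw [rOperation_iff_laws₁₂ F N θ w P hup, densitiesDescribed_iff_sLaw₁₂ F N θ h w P hC]

/-- **What N11 SAYS at Stage 12** (A4 locator, NON-VACUOUS: `SLaw₁₂ θ P 0` holds, the rest are the repaired format laws): N11 at a Stage-12-bound run, with its
in-edge leaves, the small-field implication, the flow-control implication, law transport along the tower of record and the interval hypothesis, YIELDS the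
repaired §2 [III] form of record of EVERY density `ρ_k`, `k ≤ K`. [cite: Balaban1988Convergent, Thm 1 p.262, (2.18) p.257, (2.23)–(2.42) pp.258–261 (what the node asserts at the objects of record)] -/
theorem sLaw₁₂_all_of_b14_main (hC : w.C = (datumOfRecord₁₂ F N θ h).C) (hup : w.up P = upOfRecord₅C F N (θ.toStage5₁₂ F N) P)
    (hN : Dag.B14_main (leavesP w P)) (h7 : (leavesP w P).b7) (h8 : (leavesP w P).b8) (h9 : (leavesP w P).b9) (h10 : (leavesP w P).b10)
    (h11 : (leavesP w P).b11) (hsf : (leavesP w P).smallCouplings → (leavesP w P).smallFieldInductive)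
    (hfc : (leavesP w P).smallCouplings → (leavesP w P).flowControl) (hR : ∀ k, k < P.K → TLaw₁₂ F N θ P k → SLaw₁₂ F N θ P (k + 1))
    (hsc : (leavesP w P).smallCouplings) : ∀ k, k ≤ P.K → SLaw₁₂ F N θ P k :=
  (b14_main_iff_at_record₁₂ F N θ h w P hC hup).1 hN h7 h8 h9 h10 h11 hsf hfc hR hsc

end Pointed

/-- **THEOREM 1 [III]'s CONCLUSION ALONG A RUN FROM (S1ᵀ) AND THE LEAF'S LAW TRANSPORT, NO WORLD** — the induction (0.2) of [Balaban1988Convergent] p. 262 at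
the objects of record (`B14.inductiveAssumptions_of_thmP245`'s logic: start `sLaw₁₂_zero`, step `SLaw₁₂ k → TLaw₁₂ k → SLaw₁₂ (k+1)`): for every `θ` and run,
(S1ᵀ) `∀ k < K, SLaw₁₂ θ P k → TLaw₁₂ θ P k` and (𝐑) `∀ k < K, TLaw₁₂ θ P k → SLaw₁₂ θ P (k+1)` give `∀ k ≤ K, SLaw₁₂ θ P k`.  Pure logic.
[cite: Balaban1988Convergent, Thm 1 p.262, Theorem p.245, p.244 (the printed induction at the objects of record)] -/
theorem sLaw₁₂_all_of_tLaw (θ : Stage12Params F N) (P : B12.RunParams)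
    (hT : ∀ k, k < P.K → SLaw₁₂ F N θ P k → TLaw₁₂ F N θ P k) (hR : ∀ k, k < P.K → TLaw₁₂ F N θ P k → SLaw₁₂ F N θ P (k + 1)) :
    ∀ k, k ≤ P.K → SLaw₁₂ F N θ P k := by
  intro k
  induction k with
  | zero => exact fun _ => sLaw₁₂_zero F N θ P
  | succ k ih => exact fun hk => hR k hk (hT k hk (ih (Nat.le_of_succ_le hk)))

/-- **THEOREM 1 [III] AT STAGE 12 RELATIVE TO 𝐑, BY NAME** (the N11∕N13 junction, cf. seat dag-n11-e's `B14NodeKnitRecord11R.sLaw₁₁_all_of_rAssumedP244` at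
Stage 11): the record's 𝐑-leaf at the pinned carriers `DagBinding.ROpLeaf (VOfRecord₁₂ F N θ P)` (= [III] p. 244's assumed property of 𝐑 at the objects of
record, `rOpLeaf_VOfRecord₁₂_iff`; node N13's product) + (S1ᵀ) give the repaired §2 form of EVERY density of record `ρ_k`, `k ≤ K` — no world, no start
hypothesis. [cite: Balaban1988Convergent, Thm 1 p.262, Theorem p.245, p.244; Balaban1989LargeFieldII, Thm 1 p.355] -/
theorem sLaw₁₂_all_of_rOpLeaf (θ : Stage12Params F N) (P : B12.RunParams)
    (hT : ∀ k, k < P.K → SLaw₁₂ F N θ P k → TLaw₁₂ F N θ P k) (hR : DagBinding.ROpLeaf (VOfRecord₁₂ F N θ P)) :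
    ∀ k, k ≤ P.K → SLaw₁₂ F N θ P k :=
  sLaw₁₂_all_of_tLaw F N θ P hT ((rOpLeaf_VOfRecord₁₂_iff F N θ P).1 hR)

/-! ## §2. KEYED on the record predicate `IsRecordOfRecord₁₂C`; the route's stub `S_N11` -/

section Keyed

variable {F N}
variable {D : FiniteEpsData F (SU N)} {w : WorldP}

/-- **N04's leaf `b7` HOLDS OUTRIGHT at every run of every Stage-12 record** (N01 `b4`, N02 `b4 → b5`, N04 `b5 → b7` are NODE 00 theorems at the ₅C shadow,
transferred by `Record12` §7 — `Node00.b4∕b5∕b7_main_of_isRecordOfRecord₁₂C`). [cite: Balaban1985Averaging, Props. 1–10 pp.26–50 (kernel version at the objects of record, transferred; bookkeeping)] -/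
theorem leaf_b7_of_isRecordOfRecord₁₂C (hrec : IsRecordOfRecord₁₂C F N D w) (P : B12.RunParams) : (leavesP w P).b7 :=
  b7_main_of_isRecordOfRecord₁₂C hrec P (b5_main_of_isRecordOfRecord₁₂C hrec P (b4_main_of_isRecordOfRecord₁₂C hrec P))

/-- **In-edge guards at every run of a Stage-12 record**: `b4`, `b5`, `b7` HOLD (only `b8 b9 b10 b11` — N05 ∕ N06 ∕ N08 ∕ N07 — remain antecedents).
[cite: Balaban1983RegularityDecay, Theorem p.573; Balaban1984PropagatorsI, Props. 1.1–1.2 pp.33–36; Balaban1985Averaging, Props. 1–10 pp.26–50 (kernel versions, transferred; bookkeeping)] -/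
theorem guards_of_isRecordOfRecord₁₂C (hrec : IsRecordOfRecord₁₂C F N D w) (P : B12.RunParams) :
    (leavesP w P).b4 ∧ (leavesP w P).b5 ∧ (leavesP w P).b7 :=
  have h4 : (leavesP w P).b4 := b4_main_of_isRecordOfRecord₁₂C hrec P
  have h5 : (leavesP w P).b5 := b5_main_of_isRecordOfRecord₁₂C hrec P h4
  ⟨h4, h5, b7_main_of_isRecordOfRecord₁₂C hrec P h5⟩

/-- **N11 AT EVERY RUN OF A STAGE-12 RECORD from (S1ᵀ) at the objects of record of every presenting parameter**: if for every admissible `θ` satisfying its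
provisos and presenting `D` (with the world's binding clauses) and every run, the Theorem of [Balaban1988Convergent] p. 245 holds at the objects of record
given N11's antecedents (`SLaw₁₂ θ P k → TLaw₁₂ θ P k`, `k < K`), then `Dag.B14_main (leavesP w P)` at every run `P` — the START being `sLaw₁₂_zero` and the (𝐑)
slot the record's pin. [cite: Balaban1988Convergent, Thm 1 p.262; Theorem p.245; p.244; Balaban1989LargeFieldII, Thm 1 p.355] -/
theorem b14_main_of_isRecordOfRecord₁₂C (hrec : IsRecordOfRecord₁₂C F N D w)
    (step : ∀ (θ : Stage12Params F N) (h : θ.Provisos₁₂ F N), θ.Admissible F N → D = datumOfRecord₁₂ F N θ h →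
      w.C = (datumOfRecord₁₂ F N θ h).C → (0 < w.γ ∧ w.γ ≤ θ.γ) → w.L = (θ.L : ℝ) →
      (∀ P, w.up P = upOfRecord₅C F N (θ.toStage5₁₂ F N) P) → ∀ P : B12.RunParams,
        (leavesP w P).b7 → (leavesP w P).b8 → (leavesP w P).b9 → (leavesP w P).b10 → (leavesP w P).b11 →
          (leavesP w P).smallCouplings → (leavesP w P).smallFieldInductive → (leavesP w P).flowControl →
            ∀ k, k < P.K → SLaw₁₂ F N θ P k → TLaw₁₂ F N θ P k) :
    ∀ P : B12.RunParams, Dag.B14_main (leavesP w P) := by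
  intro P
  obtain ⟨θ, h, hθ, hD, hC, hγ, hL, hup⟩ := hrec
  exact b14_main_at_record₁₂ F N θ h w P (by rw [hC, hD]) (hup P) (step θ h hθ hD (by rw [hC, hD]) hγ hL hup P)

/-- **`S_N11 Rec` FOR EVERY RECORD PREDICATE REFINING THE STAGE-12 RECORD** (the route's node stub `YMDAG.UVSplit.S_N11 Rec := AtRecord Rec Dag.B14_main`), from
(S1ᵀ) alone at the objects of record of every presenting Stage-12 parameter of every `Rec`-world.
[cite: Balaban1988Convergent, Thm 1 p.262; Theorem p.245; p.244; (2.18) p.257; Balaban1989LargeFieldII, Thm 1 p.355] -/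
theorem s_N11_of_refines₁₂C (Rec : RecordPred N)
    (href : ∀ (F : T4Family) (D : Datum F N) (w : WorldP), Rec F D w → IsRecordOfRecord₁₂C F N D w)
    (step : ∀ (F : T4Family) (D : Datum F N) (w : WorldP), Rec F D w →
      ∀ (θ : Stage12Params F N) (h : θ.Provisos₁₂ F N), θ.Admissible F N → D = datumOfRecord₁₂ F N θ h →
        w.C = (datumOfRecord₁₂ F N θ h).C → (0 < w.γ ∧ w.γ ≤ θ.γ) → w.L = (θ.L : ℝ) →
        (∀ P, w.up P = upOfRecord₅C F N (θ.toStage5₁₂ F N) P) → ∀ P : B12.RunParams,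
          (leavesP w P).b7 → (leavesP w P).b8 → (leavesP w P).b9 → (leavesP w P).b10 → (leavesP w P).b11 →
            (leavesP w P).smallCouplings → (leavesP w P).smallFieldInductive → (leavesP w P).flowControl →
              ∀ k, k < P.K → SLaw₁₂ F N θ P k → TLaw₁₂ F N θ P k) :
    S_N11 Rec :=
  fun F D w hR P => b14_main_of_isRecordOfRecord₁₂C (href F D w hR) (step F D w hR) P

/-- **`S_N11` AT THE STAGE-12 RECORD ITSELF** (`Rec := IsRecordOfRecord₁₂C · N`; the route instantiates `N := 2`): N11 at every run of every Stage-12 record's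
world from (S1ᵀ) ALONE — THE THEOREM OF [Balaban1988Convergent] p. 245 at the objects of record being the one displayed estimate; the start is a theorem, the
𝐑-half the record's pin. [cite: Balaban1988Convergent, Thm 1 p.262; Theorem p.245; p.244; Balaban1989LargeFieldII, Thm 1 p.355] -/
theorem s_N11_rec₁₂C
    (step : ∀ (F : T4Family) (D : Datum F N) (w : WorldP), IsRecordOfRecord₁₂C F N D w →
      ∀ (θ : Stage12Params F N) (h : θ.Provisos₁₂ F N), θ.Admissible F N → D = datumOfRecord₁₂ F N θ h →
        w.C = (datumOfRecord₁₂ F N θ h).C → (0 < w.γ ∧ w.γ ≤ θ.γ) → w.L = (θ.L : ℝ) →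
        (∀ P, w.up P = upOfRecord₅C F N (θ.toStage5₁₂ F N) P) → ∀ P : B12.RunParams,
          (leavesP w P).b7 → (leavesP w P).b8 → (leavesP w P).b9 → (leavesP w P).b10 → (leavesP w P).b11 →
            (leavesP w P).smallCouplings → (leavesP w P).smallFieldInductive → (leavesP w P).flowControl →
              ∀ k, k < P.K → SLaw₁₂ F N θ P k → TLaw₁₂ F N θ P k) :
    S_N11 (fun F D w => IsRecordOfRecord₁₂C F N D w) :=
  s_N11_of_refines₁₂C _ (fun _ _ _ hR => hR) step

end Keyed

/-! ## §3. THE (B)-FACE: [V] Theorem 1's first conjunct (`B16.Thm1Printed`) from N11 at all runs of a world — the DAG's reading of the route's K1′ -/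

section BFace

variable {F N}

/-- **`B16.Thm1Printed D.C` FROM NODE N11 AT EVERY RUN OF A WORLD BOUND TO `D.C`** (generic, any binding world with `0 < w.γ`): if `Dag.B14_main (leavesP w P)`
holds at every run and, at every run INSIDE the world's window `]0, w.γ]`, N11's antecedents hold — the in-edges `b7 … b11` ([12] = B7, [14] = B8, [13] = B9,
[16] = B10, [15] = B11), the small-field inductive assumptions ([I], [II]), the flow control (2.6) and the 𝐑-leaf ([II′] Thm 1 for 𝐑) —, then Theorem 1's
typed conclusion `B16.Thm1Printed D.C` ([Balaban1989LargeFieldII] Thm 1 p. 355 = [III] Thm 1 p. 262: «∃ γ > 0, ∀ runs in the γ-window, ∀ k ≤ K, ρ_k has the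
§2 form») holds with `γ := w.γ`.  Pure logic over the binding (`smallCouplings` = the window clause, `densitiesDescribed` = the conclusion).
[cite: Balaban1989LargeFieldII, Thm 1 p.355; Balaban1988Convergent, Thm 1 p.262 (bookkeeping: the node's conclusion IS Theorem 1's clause)] -/
theorem thm1Printed_of_b14_main_all (D : FiniteEpsData F (SU N)) (w : WorldP) (hC : w.C = D.C) (hγ : 0 < w.γ)
    (hN11 : ∀ P : B12.RunParams, Dag.B14_main (leavesP w P))
    (hant : ∀ P : B12.RunParams, (leavesP w P).smallCouplings →
      (leavesP w P).b7 ∧ (leavesP w P).b8 ∧ (leavesP w P).b9 ∧ (leavesP w P).b10 ∧ (leavesP w P).b11 ∧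
        (leavesP w P).smallFieldInductive ∧ (leavesP w P).flowControl ∧ (leavesP w P).rOperation) :
    B16.Thm1Printed D.C := by
  refine ⟨w.γ, hγ, fun P hP k hk => ?_⟩
  have hsc : (leavesP w P).smallCouplings := by
    show (w.C P).flow.InInterval w.γ P.K
    rw [hC]; exact hP
  obtain ⟨h7, h8, h9, h10, h11, hsf, hfc, hrop⟩ := hant P hsc
  have hk' : (w.C P).Sect2Form k := hN11 P h7 h8 h9 h10 h11 (fun _ => hsf) (fun _ => hfc) hrop hsc k hk
  rw [hC] at hk'
  exact hk'

variable {D : FiniteEpsData F (SU N)} {w : WorldP}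

/-- **AT A STAGE-12 RECORD: Theorem 1's conjunct of (B) from (S1ᵀ) at the presenting parameters + N11's antecedents inside the window** — §2's
`b14_main_of_isRecordOfRecord₁₂C` composed with `thm1Printed_of_b14_main_all` (`w.C = D.C`, `0 < w.γ` are binding clauses of the record).  What the
route's K1′ witness owes N11, by name: (S1ᵀ) at ITS `θ`, and the antecedent leaves at its windowed runs. [cite: Balaban1989LargeFieldII, Thm 1 p.355; Balaban1988Convergent, Thm 1 p.262, Theorem p.245] -/
theorem thm1Printed_of_isRecordOfRecord₁₂C_of_tLaw (hrec : IsRecordOfRecord₁₂C F N D w)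
    (step : ∀ (θ : Stage12Params F N) (h : θ.Provisos₁₂ F N), θ.Admissible F N → D = datumOfRecord₁₂ F N θ h →
      w.C = (datumOfRecord₁₂ F N θ h).C → (0 < w.γ ∧ w.γ ≤ θ.γ) → w.L = (θ.L : ℝ) →
      (∀ P, w.up P = upOfRecord₅C F N (θ.toStage5₁₂ F N) P) → ∀ P : B12.RunParams,
        (leavesP w P).b7 → (leavesP w P).b8 → (leavesP w P).b9 → (leavesP w P).b10 → (leavesP w P).b11 →
          (leavesP w P).smallCouplings → (leavesP w P).smallFieldInductive → (leavesP w P).flowControl →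
            ∀ k, k < P.K → SLaw₁₂ F N θ P k → TLaw₁₂ F N θ P k)
    (hant : ∀ P : B12.RunParams, (leavesP w P).smallCouplings →
      (leavesP w P).b7 ∧ (leavesP w P).b8 ∧ (leavesP w P).b9 ∧ (leavesP w P).b10 ∧ (leavesP w P).b11 ∧
        (leavesP w P).smallFieldInductive ∧ (leavesP w P).flowControl ∧ (leavesP w P).rOperation) :
    B16.Thm1Printed D.C :=
  thm1Printed_of_b14_main_all D w (construction_eq_of_isRecordOfRecord₁₂C hrec) (gamma_pos_of_isRecordOfRecord₁₂C hrec)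
    (b14_main_of_isRecordOfRecord₁₂C hrec step) hant

end BFace

end Summit.QuantumFields.YangMills.Theorems.BalabanUVNodesN11AtRecord12C

end
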